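import Summits.QuantumFields.BalabanUV.T4Continuum.Support.GaugeTermBalabanData

/-!
# T⁴ programme, spine node NE2 (U1a), tier B row B4.b — THE B4 SLOT's SMALL-FIELD CONDITIONS, EXPLICIT IN THE PRIMARY SIZES
# (`α, β, τ ≤ η`, `η·K_B4(d, a′) ≤ 1`; row B4.b, wiring file 5)

ROUND-2 swarm `t4-ne2-formalise-*`, leaf prover 05 (GEN 2), row **B4.b**.  `Support/GaugeTermBalabanData.perturbationLaws_gaugeSlot_balabanData`
(file 4) displays the B4 slot's two smallness conditions on DERIVED constants — `kappaS d a′ α β τ < 1` (the scalar layer's Neumann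
condition, row B4.e) and `σ₀⁻²·deltaK (gS …) (1+τ) (dα) τ a′ < 1` (the unit-layer Gram inversion, row B4.b) — and the slot's size
`κ₄ = kappaGS d a a′ (kappaS …) α τ` enters row B7's threshold `κ₄ ≤ η`.  This file makes all three EXPLICIT in the primary sizes of the
data: the connection's size ∕ lattice-Lipschitz numbers `α, β` (row B5's class) and the site transports' size `τ`:
 * §1 `Ginv d a′ := γ′⁻¹ ≥ 1`, **`KS`**, `kappaS_le_of_small : α, β, τ ≤ η ≤ 1 ⟹ kappaS ≤ KS(d,a′)·η`; `gS` two-sided bounds for `κs ≤ ½`;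
 * §2 polynomial bounds in the resolvent size `g ≥ 1`: `deltaK … ≤ (4g² + 16dg³ + 32a′g³)·η`, `deltaZ … ≤ (g + 6dg + 8a′g²)·η`,
   and `kappaGT … ≤ Cst·8gN(KZ + N·KD)·η` once `N·δK ≤ ½`;
 * §3 **`KD`**, **`KZ0`**, **`KG`**, **`KB4 d a′ := 2·KS + 2·KD`** and **`gaugeSlot_small_of_le`**: `0 ≤ α, β, τ ≤ η ≤ 1`, `η·KB4(d,a′) ≤ 1` ⟹
   `kappaS … ≤ ½` ∧ `σ₀⁻²·deltaK (gS d a′ (kappaS …)) (1+τ) (dα) τ a′ ≤ ½` ∧ `kappaGS d a a′ (kappaS …) α τ ≤ KG(d,a,a′)·η`;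
 * §4 **`perturbationLaws_gaugeSlot_balabanData_of_small`**: file 4's slot law with the two displayed inequalities REPLACED by
   `α, β, τ ≤ η ≤ 1`, `η·KB4(d, a′) ≤ 1` (all constants explicit, OURS), and **`kappaGS_le_of_small`** for row B7's `κ₄ ≤ η′` bookkeeping
   (`η′ := KG·η`).

HONEST FRAMING (T4-DAG p. 1).  Elementary real inequalities, OURS (no sharpness claimed; the constants are generous polynomials in
`γ′⁻¹ = gammaPs⁻¹`, `σ₀⁻²`, `d`, `a′`, `Cst(d,a)`); `R`, `T`, `a′` DATA; MODEL LEVEL, no B0 (c5); CONDITIONAL on node NE3 ∕ the regularity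
class where the structures are fed from them (rows B5 ∕ B6); NOT [B9] (3.23)–(3.26) as printed; **NE2 NOT PROVED**; NOT infinite volume, NOT
a mass gap, NOT Clay, NOT summit progress; spine 0/9 unchanged.  HONEST DEPENDENCY: continuum YM on T⁴ ⇐ BetaPertH ∧ nine spine estimates
(0/9 proved); BetaPertH ⇐ (D1) ∧ (D4) ∧ CAP+tail; G-an2-4 gates asym, D1 and NE2/3/4.  ABSOLUTE RULE kept; no `sorry`.
-/

noncomputable section

open scoped BigOperators ComplexConjugate Matrix Matrix.Norms.L2Operator Kronecker ComplexOrder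

namespace Summit.QuantumFields.BalabanUV.T4Continuum.GaugeTermThreshold

open Literature.MathematicalPhysics.QuantumFieldTheory.Balaban1983to89.B5Prop11Plancherel
open Literature.MathematicalPhysics.QuantumFieldTheory.Balaban1983to89.B5G183RateUnitTower (lev lev_neZero)
open Summit.QuantumFields.BalabanUV.T4Continuum
open Summit.QuantumFields.BalabanUV.T4Continuum.BackgroundResolventTower
open Summit.QuantumFields.BalabanUV.T4Continuum.KingPairingPlantedLaw
open Summit.QuantumFields.BalabanUV.T4Continuum.BlockMultiplication
open Summit.QuantumFields.BalabanUV.T4Continuum.GaugeTermSandwichLaw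
open Summit.QuantumFields.BalabanUV.T4Continuum.GaugeTermLayer
open Summit.QuantumFields.BalabanUV.T4Continuum.GaugeTermPerturbationLaw
open Summit.QuantumFields.BalabanUV.T4Continuum.GaugeTermScalarData
open Summit.QuantumFields.BalabanUV.T4Continuum.GaugeTermInstanceGeom
open Summit.QuantumFields.BalabanUV.T4Continuum.GaugeTermBalabanData
open Summit.QuantumFields.BalabanUV.T4Continuum.ScalarAveragedPropagator (DeltaPs gammaPs gammaPs_pos)
open Summit.QuantumFields.BalabanUV.T4Continuum.ScalarAveragedCompression (sigma0 sigma0_pos)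
open Summit.QuantumFields.BalabanUV.T4Continuum.ScalarCovariantLaplacian (scalarPert kappaS)
open Summit.QuantumFields.BalabanUV.T4Continuum.ScalarCovariantLaplacianLaws (ConnectionLaws0 SiteTransportLaws0)
open Summit.QuantumFields.BalabanUV.T4Continuum.NE2BalabanGauge (gaugeSlot)

/-! ## §1 The scalar layer's Neumann constant and the resolvent size -/

section Scalar

variable {d : ℕ} {a' α β τ η κs : ℝ}

/-- `γ′⁻¹`, the free scalar resolvent size (`≥ 1`). [folklore] -/
def Ginv (d : ℕ) (a' : ℝ) : ℝ := (gammaPs d a')⁻¹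

/-- `1 ≤ γ′⁻¹` (since `0 < γ′ ≤ 1`). [folklore] -/
theorem one_le_Ginv (d : ℕ) (a' : ℝ) : 1 ≤ Ginv d a' :=
  (one_le_inv₀ (gammaPs_pos (d := d) (a' := a')).1).mpr (gammaPs_pos (d := d) (a' := a')).2

/-- `0 ≤ γ′⁻¹`. [folklore] -/
theorem Ginv_nonneg (d : ℕ) (a' : ℝ) : 0 ≤ Ginv d a' := zero_le_one.trans (one_le_Ginv d a')

/-- **the constant of `kappaS ≤ KS·η`**: `KS = d(2√(γ′⁻¹) + 4γ′⁻¹) + 3a′γ′⁻¹`. [folklore] -/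
def KS (d : ℕ) (a' : ℝ) : ℝ := d * (2 * Real.sqrt (Ginv d a') + 4 * Ginv d a') + 3 * a' * Ginv d a'

/-- `0 ≤ KS` for `a′ ≥ 0`. [folklore] -/
theorem KS_nonneg (ha' : 0 ≤ a') : 0 ≤ KS d a' := by
  have := Ginv_nonneg d a'; unfold KS; positivity

/-- **`kappaS ≤ KS·η`** for `0 ≤ α ≤ η`, `β ≤ η`, `0 ≤ τ ≤ η ≤ 1`, `a′ ≥ 0`. [folklore] -/
theorem kappaS_le_of_small (ha' : 0 ≤ a') (hα : 0 ≤ α) (hαη : α ≤ η) (hβη : β ≤ η) (hτ : 0 ≤ τ) (hτη : τ ≤ η)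
    (hη1 : η ≤ 1) : kappaS d a' α β τ ≤ KS d a' * η := by
  have hG := Ginv_nonneg d a'
  have hsG : 0 ≤ Real.sqrt (Ginv d a') := Real.sqrt_nonneg _
  have hη0 : 0 ≤ η := hα.trans hαη
  have hd : (0 : ℝ) ≤ d := Nat.cast_nonneg d
  have hα2 : α ^ 2 ≤ η := by nlinarith
  have hτ3 : τ * (2 + τ) ≤ 3 * η := by nlinarith
  have h1 : (d : ℝ) * (2 * α * Real.sqrt (Ginv d a') + β * Ginv d a') ≤ d * (2 * η * Real.sqrt (Ginv d a') + η * Ginv d a') := by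
    apply mul_le_mul_of_nonneg_left _ hd
    exact add_le_add (by nlinarith) (mul_le_mul_of_nonneg_right hβη hG)
  have h2 : (d : ℝ) * (α ^ 2 + 2 * β) * Ginv d a' ≤ d * (3 * η) * Ginv d a' := by
    apply mul_le_mul_of_nonneg_right _ hG
    exact mul_le_mul_of_nonneg_left (by linarith) hd
  have h3 : a' * (τ * (2 + τ)) * Ginv d a' ≤ a' * (3 * η) * Ginv d a' :=
    mul_le_mul_of_nonneg_right (mul_le_mul_of_nonneg_left hτ3 ha') hG
  unfold kappaS; rw [show (gammaPs d a')⁻¹ = Ginv d a' from rfl]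
  unfold KS
  nlinarith [h1, h2, h3]

/-- `0 ≤ kappaS` for nonnegative sizes. [folklore] -/
theorem kappaS_nonneg (ha' : 0 ≤ a') (hα : 0 ≤ α) (hβ : 0 ≤ β) (hτ : 0 ≤ τ) : 0 ≤ kappaS d a' α β τ := by
  have hG := Ginv_nonneg d a'
  unfold kappaS; rw [show (gammaPs d a')⁻¹ = Ginv d a' from rfl]
  positivity

/-- **two-sided bounds on the perturbed resolvent size** `gS = γ′⁻¹(1 − κs)⁻¹` for `0 ≤ κs ≤ ½`: `γ′⁻¹ ≤ gS ≤ 2γ′⁻¹`, hence `1 ≤ gS`.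
[folklore] -/
theorem gS_bounds (hκ0 : 0 ≤ κs) (hκ : κs ≤ 1 / 2) :
    Ginv d a' ≤ gS d a' κs ∧ gS d a' κs ≤ 2 * Ginv d a' ∧ 1 ≤ gS d a' κs := by
  have hG := Ginv_nonneg d a'
  have hG1 := one_le_Ginv d a'
  have hν1 : 1 ≤ (1 - κs)⁻¹ := (one_le_inv₀ (by linarith)).mpr (by linarith)
  have hν2 : (1 - κs)⁻¹ ≤ 2 := by
    rw [inv_le_comm₀ (by linarith) (by norm_num)]; linarith
  have e : gS d a' κs = Ginv d a' * (1 - κs)⁻¹ := rfl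
  refine ⟨?_, ?_, ?_⟩
  · rw [e]; exact le_mul_of_one_le_right hG hν1
  · rw [e, mul_comm 2]; exact mul_le_mul_of_nonneg_left hν2 hG
  · rw [e]; nlinarith

end Scalar

/-! ## §2 Polynomial bounds in the resolvent size `g ≥ 1` -/

section Poly

variable {d : ℕ} {g α₁ τ η a' N : ℝ}

/-- `√g ≤ g` and `√g·√g = g` for `g ≥ 1`. [folklore] -/
theorem sqrt_facts_of_one_le (hg1 : 1 ≤ g) : 0 ≤ Real.sqrt g ∧ Real.sqrt g ≤ g ∧ Real.sqrt g * Real.sqrt g = g := by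
  have hg0 : 0 ≤ g := zero_le_one.trans hg1
  have hss := Real.mul_self_sqrt hg0
  have h1 : 1 ≤ Real.sqrt g := Real.one_le_sqrt.mpr hg1
  refine ⟨Real.sqrt_nonneg g, ?_, hss⟩
  calc Real.sqrt g = Real.sqrt g * 1 := (mul_one _).symm
    _ ≤ Real.sqrt g * Real.sqrt g := mul_le_mul_of_nonneg_left h1 (Real.sqrt_nonneg g)
    _ = g := hss

/-- **`deltaK g (1+τ) α₁ τ a′ ≤ (4g² + 16dg³ + 32a′g³)·η`** for `g ≥ 1`, `0 ≤ α₁ ≤ dη`, `0 ≤ τ ≤ η ≤ 1`, `a′ ≥ 0`. [folklore] -/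
theorem deltaK_le_of_small (hg1 : 1 ≤ g) (ha' : 0 ≤ a') (hα1 : 0 ≤ α₁) (hα1η : α₁ ≤ d * η) (hτ : 0 ≤ τ) (hτη : τ ≤ η)
    (hη1 : η ≤ 1) : deltaK g (1 + τ) α₁ τ a' ≤ (4 * g ^ 2 + 16 * d * g ^ 3 + 32 * a' * g ^ 3) * η := by
  obtain ⟨hs0, hsg, hss⟩ := sqrt_facts_of_one_le hg1
  have hg0 : 0 ≤ g := zero_le_one.trans hg1
  have hη0 : 0 ≤ η := hτ.trans hτη
  have hd : (0 : ℝ) ≤ d := Nat.cast_nonneg d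
  have hq0 : 0 ≤ 1 + τ := by linarith
  have hq2 : 1 + τ ≤ 2 := by linarith
  set s := Real.sqrt g with hs
  -- the inner bracket
  have hA : s * α₁ * g + g * α₁ * s ≤ 2 * (d * η) * g ^ 2 := by
    have h1 : s * α₁ * g ≤ g * (d * η) * g :=
      mul_le_mul_of_nonneg_right (mul_le_mul hsg hα1η hα1 hg0) hg0
    nlinarith [h1]
  have hB : g * (a' * (τ * ((1 + τ) + (1 + τ)))) * g ≤ 4 * a' * η * g ^ 2 := by
    have h1 : τ * ((1 + τ) + (1 + τ)) ≤ 4 * η := by nlinarith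
    have h2 : a' * (τ * ((1 + τ) + (1 + τ))) ≤ a' * (4 * η) := mul_le_mul_of_nonneg_left h1 ha'
    nlinarith [h2, mul_nonneg hg0 hg0]
  have hinner0 : 0 ≤ s * α₁ * g + g * α₁ * s + g * (a' * (τ * ((1 + τ) + (1 + τ)))) * g := by positivity
  have hinner : τ * g + (1 + τ) * (s * α₁ * g + g * α₁ * s + g * (a' * (τ * ((1 + τ) + (1 + τ)))) * g)
      ≤ η * (g + 4 * d * g ^ 2 + 8 * a' * g ^ 2) := by
    have h1 : τ * g ≤ η * g := mul_le_mul_of_nonneg_right hτη hg0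
    have h2 : (1 + τ) * (s * α₁ * g + g * α₁ * s + g * (a' * (τ * ((1 + τ) + (1 + τ)))) * g)
        ≤ 2 * (2 * (d * η) * g ^ 2 + 4 * a' * η * g ^ 2) :=
      mul_le_mul hq2 (add_le_add hA hB) hinner0 (by norm_num)
    nlinarith [h1, h2]
  have houter : (1 + τ) * g + (1 + τ) * g ≤ 4 * g := by nlinarith
  have houter0 : 0 ≤ (1 + τ) * g + (1 + τ) * g := by positivity
  have hinnerT0 : 0 ≤ τ * g + (1 + τ) * (s * α₁ * g + g * α₁ * s + g * (a' * (τ * ((1 + τ) + (1 + τ)))) * g) := by positivity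
  have hpoly0 : 0 ≤ η * (g + 4 * d * g ^ 2 + 8 * a' * g ^ 2) := by positivity
  unfold deltaK
  calc _ ≤ (η * (g + 4 * d * g ^ 2 + 8 * a' * g ^ 2)) * (4 * g) := mul_le_mul hinner houter houter0 hpoly0
    _ = (4 * g ^ 2 + 16 * d * g ^ 3 + 32 * a' * g ^ 3) * η := by ring

/-- **`deltaZ g (1+τ) α₁ τ a′ ≤ (g + 6dg + 8a′g²)·η`** under the same hypotheses. [folklore] -/
theorem deltaZ_le_of_small (hg1 : 1 ≤ g) (ha' : 0 ≤ a') (hα1 : 0 ≤ α₁) (hα1η : α₁ ≤ d * η) (hτ : 0 ≤ τ) (hτη : τ ≤ η)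
    (hη1 : η ≤ 1) : deltaZ g (1 + τ) α₁ τ a' ≤ (g + 6 * d * g + 8 * a' * g ^ 2) * η := by
  obtain ⟨hs0, hsg, hss⟩ := sqrt_facts_of_one_le hg1
  have hg0 : 0 ≤ g := zero_le_one.trans hg1
  have hη0 : 0 ≤ η := hτ.trans hτη
  have hd : (0 : ℝ) ≤ d := Nat.cast_nonneg d
  have hq0 : 0 ≤ 1 + τ := by linarith
  have hq2 : 1 + τ ≤ 2 := by linarith
  set s := Real.sqrt g with hs
  have h0 : τ * s ≤ η * g := mul_le_mul hτη hsg hs0 hη0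
  have hA : 2 * g * α₁ + s * α₁ * s ≤ 3 * (d * η) * g := by
    have e : s * α₁ * s = α₁ * g := by rw [mul_comm s α₁, mul_assoc, hss]
    rw [e]; nlinarith [mul_le_mul_of_nonneg_right hα1η hg0]
  have hB : g * (a' * (τ * ((1 + τ) + (1 + τ)))) * s ≤ 4 * a' * η * g ^ 2 := by
    have h1 : τ * ((1 + τ) + (1 + τ)) ≤ 4 * η := by nlinarith
    have h2 : a' * (τ * ((1 + τ) + (1 + τ))) ≤ a' * (4 * η) := mul_le_mul_of_nonneg_left h1 ha'
    have h3 : g * (a' * (τ * ((1 + τ) + (1 + τ)))) * s ≤ g * (a' * (4 * η)) * g :=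
      mul_le_mul (mul_le_mul_of_nonneg_left h2 hg0) hsg hs0 (by positivity)
    nlinarith [h3]
  have hbr0 : 0 ≤ 2 * g * α₁ + s * α₁ * s + g * (a' * (τ * ((1 + τ) + (1 + τ)))) * s := by positivity
  have h2 : (1 + τ) * (2 * g * α₁ + s * α₁ * s + g * (a' * (τ * ((1 + τ) + (1 + τ)))) * s)
      ≤ 2 * (3 * (d * η) * g + 4 * a' * η * g ^ 2) := mul_le_mul hq2 (add_le_add hA hB) hbr0 (by norm_num)
  unfold deltaZ
  nlinarith [h0, h2]

/-- **`kappaGT ≤ Cst·(8gN·KZ + 8gN²·KD)·η`** from `δZ ≤ KZ·η`, `δK ≤ KD·η`, `N·δK ≤ ½`, `g ≥ 1`, `q = 1 + τ ≤ 2`. [folklore] -/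
theorem kappaGT_le_of_small {a : ℝ} {KZ KD : ℝ} (hg1 : 1 ≤ g) (hτ : 0 ≤ τ) (hτ1 : τ ≤ 1) (hN : 0 ≤ N)
    (hδK0 : 0 ≤ deltaK g (1 + τ) α₁ τ a') (hδZ0 : 0 ≤ deltaZ g (1 + τ) α₁ τ a')
    (hδZ : deltaZ g (1 + τ) α₁ τ a' ≤ KZ * η) (hδK : deltaK g (1 + τ) α₁ τ a' ≤ KD * η)
    (hhalf : N * deltaK g (1 + τ) α₁ τ a' ≤ 1 / 2) :
    kappaGT d a g (1 + τ) α₁ τ a' N ≤ Cst d a * (8 * g * N * KZ + 8 * g * N ^ 2 * KD) * η := by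
  obtain ⟨hs0, hsg, hss⟩ := sqrt_facts_of_one_le hg1
  have hg0 : 0 ≤ g := zero_le_one.trans hg1
  have hC := Cst_nonneg d a
  set s := Real.sqrt g with hs
  set δK := deltaK g (1 + τ) α₁ τ a' with hK
  set δZ := deltaZ g (1 + τ) α₁ τ a' with hZ
  have hNK0 : 0 ≤ N * δK := mul_nonneg hN hδK0
  have hν0 : 0 ≤ (1 - N * δK)⁻¹ := inv_nonneg.mpr (by linarith)
  have hν2 : (1 - N * δK)⁻¹ ≤ 2 := by rw [inv_le_comm₀ (by linarith) (by norm_num)]; linarith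
  have hqs : (1 + τ) * s ≤ 2 * g := mul_le_mul (by linarith) hsg hs0 (by norm_num)
  have hqs0 : 0 ≤ (1 + τ) * s := by positivity
  have hqq : (1 + τ) * s * ((1 + τ) * s) ≤ 4 * g := by
    have e : (1 + τ) * s * ((1 + τ) * s) = (1 + τ) ^ 2 * g := by rw [← hss]; ring
    have h4 : (1 + τ) ^ 2 ≤ 4 := by nlinarith
    rw [e]; exact mul_le_mul_of_nonneg_right h4 hg0 |>.trans (le_of_eq (by ring))
  -- first term
  have hT1 : 2 * ((1 + τ) * s) * (N * (1 - N * δK)⁻¹) * δZ ≤ 8 * g * N * (KZ * η) := by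
    have h1 : N * (1 - N * δK)⁻¹ ≤ N * 2 := mul_le_mul_of_nonneg_left hν2 hN
    have h2 : 2 * ((1 + τ) * s) * (N * (1 - N * δK)⁻¹) ≤ 2 * (2 * g) * (N * 2) :=
      mul_le_mul (mul_le_mul_of_nonneg_left hqs (by norm_num)) h1 (mul_nonneg hN hν0) (by positivity)
    calc _ ≤ 2 * (2 * g) * (N * 2) * (KZ * η) := mul_le_mul h2 hδZ hδZ0 (by positivity)
      _ = 8 * g * N * (KZ * η) := by ring
  -- second term
  have hT2 : (1 + τ) * s * ((1 + τ) * s) * (N * δK * N * (1 - N * δK)⁻¹) ≤ 4 * g * (N * (KD * η) * N * 2) := by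
    have h1 : N * δK * N * (1 - N * δK)⁻¹ ≤ N * (KD * η) * N * 2 :=
      mul_le_mul (mul_le_mul_of_nonneg_right (mul_le_mul_of_nonneg_left hδK hN) hN) hν2 hν0 (by
        have := hδK0.trans hδK; positivity)
    exact mul_le_mul hqq h1 (by positivity) (by positivity)
  unfold kappaGT
  calc _ ≤ Cst d a * (8 * g * N * (KZ * η) + 4 * g * (N * (KD * η) * N * 2)) :=
        mul_le_mul_of_nonneg_left (add_le_add hT1 hT2) hC
    _ = Cst d a * (8 * g * N * KZ + 8 * g * N ^ 2 * KD) * η := by ring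

end Poly

/-! ## §3 The explicit threshold -/

section Threshold

variable {d : ℕ} {a a' α β τ η : ℝ}

/-- `KD0 = 16γ′⁻² + 128dγ′⁻³ + 256a′γ′⁻³` (the `deltaK` polynomial at `g ≤ 2γ′⁻¹`). [folklore] -/
def KD0 (d : ℕ) (a' : ℝ) : ℝ := 16 * Ginv d a' ^ 2 + 128 * d * Ginv d a' ^ 3 + 256 * a' * Ginv d a' ^ 3

/-- `KD = σ₀⁻²·KD0` (the unit-layer Gram inversion's constant: `σ₀⁻²·δK ≤ KD·η`). [folklore] -/
def KD (d : ℕ) (a' : ℝ) : ℝ := ((sigma0 d a') ^ 2)⁻¹ * KD0 d a'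

/-- `KZ0 = 2γ′⁻¹ + 12dγ′⁻¹ + 32a′γ′⁻²` (the `deltaZ` polynomial at `g ≤ 2γ′⁻¹`). [folklore] -/
def KZ0 (d : ℕ) (a' : ℝ) : ℝ := 2 * Ginv d a' + 12 * d * Ginv d a' + 32 * a' * Ginv d a' ^ 2

/-- **`KG`**: the gauge slot's size constant, `kappaGS ≤ KG·η`: `KG = Cst(d,a)·(16γ′⁻¹σ₀⁻²·KZ0 + 16γ′⁻¹σ₀⁻⁴·KD0)`. [folklore] -/
def KG (d : ℕ) (a a' : ℝ) : ℝ :=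
  Cst d a * (8 * (2 * Ginv d a') * ((sigma0 d a') ^ 2)⁻¹ * KZ0 d a' + 8 * (2 * Ginv d a') * (((sigma0 d a') ^ 2)⁻¹) ^ 2 * KD0 d a')

/-- **`KB4 = 2·KS + 2·KD`**: `η·KB4 ≤ 1` gives `kappaS ≤ ½` and `σ₀⁻²·δK ≤ ½`. [folklore] -/
def KB4 (d : ℕ) (a' : ℝ) : ℝ := 2 * KS d a' + 2 * KD d a'

/-- `0 ≤ KD0`, `0 ≤ KD`, `0 ≤ KZ0` for `a′ ≥ 0`. [folklore] -/
theorem K_nonneg (ha' : 0 ≤ a') : 0 ≤ KD0 d a' ∧ 0 ≤ KD d a' ∧ 0 ≤ KZ0 d a' := by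
  have := Ginv_nonneg d a'
  refine ⟨by unfold KD0; positivity, by unfold KD KD0; positivity, by unfold KZ0; positivity⟩

/-- **THE EXPLICIT THRESHOLD OF THE B4 SLOT**: for `0 ≤ α, β, τ ≤ η ≤ 1`, `a′ > 0` and `η·KB4(d, a′) ≤ 1` —
`kappaS d a′ α β τ ≤ ½`, `σ₀⁻²·deltaK (gS d a′ (kappaS …)) (1+τ) (dα) τ a′ ≤ ½`, and `kappaGS d a a′ (kappaS …) α τ ≤ KG(d, a, a′)·η`.
[folklore] -/
theorem gaugeSlot_small_of_le (ha' : 0 < a') (hα : 0 ≤ α) (hαη : α ≤ η) (hβ : 0 ≤ β) (hβη : β ≤ η) (hτ : 0 ≤ τ) (hτη : τ ≤ η)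
    (hη1 : η ≤ 1) (hK : η * KB4 d a' ≤ 1) :
    kappaS d a' α β τ ≤ 1 / 2
      ∧ ((sigma0 d a') ^ 2)⁻¹ * deltaK (gS d a' (kappaS d a' α β τ)) (1 + τ) (d * α) τ a' ≤ 1 / 2
      ∧ kappaGS d a a' (kappaS d a' α β τ) α τ ≤ KG d a a' * η := by
  have hη0 : 0 ≤ η := hα.trans hαη
  have hd : (0 : ℝ) ≤ d := Nat.cast_nonneg d
  have hG := Ginv_nonneg d a'
  have hN : 0 ≤ ((sigma0 d a') ^ 2)⁻¹ := inv_nonneg.mpr (sq_nonneg _)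
  obtain ⟨hKD0, hKD, hKZ0⟩ := K_nonneg (d := d) ha'.le
  have hKS := KS_nonneg (d := d) ha'.le
  -- split `η·KB4 ≤ 1`
  have hS : KS d a' * η ≤ 1 / 2 := by unfold KB4 at hK; nlinarith
  have hDη : KD d a' * η ≤ 1 / 2 := by unfold KB4 at hK; nlinarith
  -- (i) the scalar Neumann constant
  have hκ : kappaS d a' α β τ ≤ 1 / 2 := (kappaS_le_of_small ha'.le hα hαη hβη hτ hτη hη1).trans hS
  have hκ0 : 0 ≤ kappaS d a' α β τ := kappaS_nonneg ha'.le hα hβ hτ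
  obtain ⟨hgG, hg2G, hg1⟩ := gS_bounds (d := d) (a' := a') hκ0 hκ
  set g := gS d a' (kappaS d a' α β τ) with hg
  have hg0 : 0 ≤ g := zero_le_one.trans hg1
  have hα1 : 0 ≤ (d : ℝ) * α := mul_nonneg hd hα
  have hα1η : (d : ℝ) * α ≤ d * η := mul_le_mul_of_nonneg_left hαη hd
  -- (ii) δK
  have hδK := deltaK_le_of_small hg1 ha'.le hα1 hα1η hτ hτη hη1
  have hpolyK : 4 * g ^ 2 + 16 * d * g ^ 3 + 32 * a' * g ^ 3 ≤ KD0 d a' := by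
    have h2 : g ^ 2 ≤ (2 * Ginv d a') ^ 2 := pow_le_pow_left₀ hg0 hg2G 2
    have h3 : g ^ 3 ≤ (2 * Ginv d a') ^ 3 := pow_le_pow_left₀ hg0 hg2G 3
    unfold KD0; nlinarith [h2, h3, ha'.le, hd]
  have hδK' : deltaK g (1 + τ) (d * α) τ a' ≤ KD0 d a' * η := hδK.trans (mul_le_mul_of_nonneg_right hpolyK hη0)
  have hNδK : ((sigma0 d a') ^ 2)⁻¹ * deltaK g (1 + τ) (d * α) τ a' ≤ 1 / 2 := by
    calc _ ≤ ((sigma0 d a') ^ 2)⁻¹ * (KD0 d a' * η) := mul_le_mul_of_nonneg_left hδK' hN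
      _ = KD d a' * η := by unfold KD; ring
      _ ≤ 1 / 2 := hDη
  -- (iii) the slot's size
  have hδK0 : 0 ≤ deltaK g (1 + τ) (d * α) τ a' := by
    have := (sqrt_facts_of_one_le hg1).1; unfold deltaK; positivity
  have hδZ0 : 0 ≤ deltaZ g (1 + τ) (d * α) τ a' := by
    have := (sqrt_facts_of_one_le hg1).1; unfold deltaZ; positivity
  have hδZ := deltaZ_le_of_small hg1 ha'.le hα1 hα1η hτ hτη hη1
  have hpolyZ : g + 6 * d * g + 8 * a' * g ^ 2 ≤ KZ0 d a' := by
    have h2 : g ^ 2 ≤ (2 * Ginv d a') ^ 2 := pow_le_pow_left₀ hg0 hg2G 2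
    unfold KZ0; nlinarith [h2, ha'.le, hd, hg2G]
  have hδZ' : deltaZ g (1 + τ) (d * α) τ a' ≤ KZ0 d a' * η := hδZ.trans (mul_le_mul_of_nonneg_right hpolyZ hη0)
  have hGT := kappaGT_le_of_small (d := d) (a := a) hg1 hτ (hτη.trans hη1) hN hδK0 hδZ0 hδZ' hδK' hNδK
  refine ⟨hκ, hNδK, ?_⟩
  show kappaGT d a g (1 + τ) (d * α) τ a' (((sigma0 d a') ^ 2)⁻¹) ≤ KG d a a' * η
  refine hGT.trans (mul_le_mul_of_nonneg_right ?_ hη0)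
  have hC := Cst_nonneg d a
  unfold KG
  apply mul_le_mul_of_nonneg_left _ hC
  have h1 : 8 * g * ((sigma0 d a') ^ 2)⁻¹ * KZ0 d a' ≤ 8 * (2 * Ginv d a') * ((sigma0 d a') ^ 2)⁻¹ * KZ0 d a' := by
    gcongr
  have h2 : 8 * g * (((sigma0 d a') ^ 2)⁻¹) ^ 2 * KD0 d a' ≤ 8 * (2 * Ginv d a') * (((sigma0 d a') ^ 2)⁻¹) ^ 2 * KD0 d a' := by
    gcongr
  linarith [h1, h2]

end Threshold

/-! ## §4 The B4 slot on row data under the explicit threshold -/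

variable {d : ℕ} (L : ℕ) [NeZero L] (M : Fin d → ℕ) [hM : ∀ μ, NeZero (M μ)] (a : ℝ) (ha : 0 < a)
variable {o : Type*} [Fintype o] [DecidableEq o]
variable {R : (k : ℕ) → Fin d → (Tor (fine (lev L k) M) → Matrix o o ℂ)} {T : (k : ℕ) → Tor (fine (lev L k) M) → Matrix o o ℂ} {a' : ℝ}

/-- **THE GAUGE SLOT ON ROW DATA UNDER THE EXPLICIT THRESHOLD** (`d ≥ 1`, `a′ > 0`): `ConnectionLaws0 L M R α β β′ ζ`,
`SiteTransportLaws0 L M T τ τ′`, `α, β, τ ≤ η ≤ 1` and `η·KB4(d, a′) ≤ 1` ⟹ the target shape for `gaugeSlot R (QuT T) Q1 a′` with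
`κ₄ = kappaGS d a a′ (kappaS d a′ α β τ) α τ` (`≤ KG(d,a,a′)·η`, `kappaGS_le_of_small`) and `C₄ = C4data …`.  NOT NE2; model level. [folklore] -/
theorem perturbationLaws_gaugeSlot_balabanData_of_small (hd : 1 ≤ d) (ha' : 0 < a')
    {α β β' ζ τ τ' η : ℝ} (hR : ConnectionLaws0 L M R α β β' ζ) (hT : SiteTransportLaws0 L M T τ τ')
    (hαη : α ≤ η) (hβη : β ≤ η) (hτη : τ ≤ η) (hη1 : η ≤ 1) (hK : η * KB4 d a' ≤ 1) :
    PerturbationLaws (fun k => calDalev L M a ha k ⊗ₖ (1 : Matrix o o ℂ)) (gaugeSlot L M R (QuT L M o T) (Q1 L M o) a')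
      (fun k => JpcT L M k ⊗ₖ (1 : Matrix o o ℂ)) (kappaGS d a a' (kappaS d a' α β τ) α τ)
      (fun k => C4data d L a a' α β β' ζ τ τ' * ((L : ℝ)⁻¹) ^ k) := by
  obtain ⟨h1, h2, -⟩ := gaugeSlot_small_of_le (d := d) (a := a) ha' hR.nonneg.1 hαη hR.nonneg.2.1 hβη hT.nonneg.1 hτη hη1 hK
  exact perturbationLaws_gaugeSlot_balabanData L M a ha hd ha' hR hT (by linarith) (by linarith)

omit [NeZero L] hM in
/-- **`κ₄ ≤ KG·η`** under the explicit threshold — the input of row B7's `κ₄ ≤ η′` bookkeeping with `η′ := KG(d,a,a′)·η`. [folklore] -/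
theorem kappaGS_le_of_small (ha' : 0 < a') {α β β' ζ τ τ' η : ℝ} (hR : ConnectionLaws0 L M R α β β' ζ)
    (hT : SiteTransportLaws0 L M T τ τ') (hαη : α ≤ η) (hβη : β ≤ η) (hτη : τ ≤ η) (hη1 : η ≤ 1) (hK : η * KB4 d a' ≤ 1) :
    kappaGS d a a' (kappaS d a' α β τ) α τ ≤ KG d a a' * η :=
  (gaugeSlot_small_of_le (d := d) (a := a) ha' hR.nonneg.1 hαη hR.nonneg.2.1 hβη hT.nonneg.1 hτη hη1 hK).2.2

end Summit.QuantumFields.BalabanUV.T4Continuum.GaugeTermThreshold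

end
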